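import Summits.ABC.IUTFork.Repair.RHDiffPricedVsTameBand
import Summits.ABC.IUTFork.Repair.RHHeightClassGlue
import HarnessLib

/-!
# R-H ROUND 1 (D-0079 «local-height condition I06⋆», D-0107), row 16 `diffpriced` — ROW 16 ⟹ ROW 15 («slotreach») at every bad place with
# TAME DIFFERENT (`p ∤ e_w`) and UNTIED outer exponent: the row-16 twin of abc-iut-rp-m2's `RHHeightClassGlue.slotReachWindow_of_hBand` (row 8)

PROOF-ONLY file (D-0012: 0 definitions, 0 `Prop` facts; abc-iut cell, rung LADDER-ABC:A2.RESCUE.H; seat abc-iut-rh-typ-5 gen 2 = R-H ROUND 1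
PAIR n = 5 TYPER, row 16 «diffpriced» after row 5; author of the candidate abc-iut-lens-transfer-3, decl of record abc-iut-rp-s2's p458364
`Repair.RH.DiffPriced.HStarDiffPriced`; row 15's decl abc-iut-rh-typ-12's `Repair.RHSlotReach.SlotReachWindow(K)`; the band-cell ⟹ slot-cell
arithmetic abc-iut-rp-m2's `Repair.RHHeightClassGlue` (p460910 lineage) — all consumed BY NAME, nothing restated). TAKES NO SIDE on [IUTchIII]
Cor. 3.12 or on any author; every R-H candidate is a HYPOTHESIS (claim-tagged `def`), never a Literature fact; typed ≠ proved; instantiated ≠ endorsed.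

WHY (abc-iut-rh-lead 18:26:39Z / 18:43:10Z: row 16's expected word is «WINDOW-LOCATOR(k ≤ 2)» unless its slice rides a k2 DOOR of START-HERE §8 A2 (a);
rows 8 and 15 become signable through abc-iut-rp-d3's level mover `Repair.RHLevelMover` once «candidate ⟹ `SlotReachWindow`» is in kernel, as
row 8 has by `slotReachWindow_of_hBand`). THIS FILE is that implication for row 16, with its exact scope:

* §1 ARITHMETIC (`𝔪_w`-units, label `j = i+1`). At a place with tame different the row-16 cell is `(j²−1)·m_q ≤ j·(e−1)`
  (`DiffPricedVsTameBand.diffPricedCell_iff_bandTop_of_not_dvd`, p461479) = abc-iut-rp-m2's BAND CELL «`(j²−1)·m_q ≤ j·(e − B) + (1 − B)`» at `B = 1`;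
  by antitonicity (`RHHeightClassGlue.bandCell_mono`) it gives the band cell at every `B ≤ 1`, hence (`slotCell_of_bandCell`, `A = 1`) row 15's integer cell
  `e·⌊(j²·m_q − 1)/e⌋ ≤ m_q − B + j·(e − B)`. The UNTIED column value `B = r_out♯ = p^{a₀} − a₀·e` (strict minimum) always has `B ≤ 1`
  (abc-iut-rh-typ-8's `RHHeightClass.strictMinPow_le_one`), so the hypothesis `B ≤ 1` is the column's at every untied place.
* §2 FIBRE LEVEL, any pilot datum shape: `slotReachWindow_of_tameDiffCells`.
* §3 GENUINE `K`-LEVEL DATUM: `slotReachWindowK_of_hStarDiffPriced` — `HStarDiffPriced D` ⟹ `SlotReachWindowK D` at the dictionary `(e_p, n₀ ≡ 1,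
  λ ≡ −B_p/e_p, mΘ = j²·m_q, m_q = P_w ∈ ℕ)` whenever every BAD place has `p ∤ e_w`, `e_w = e_p` and `B_p ≤ 1`; `…_of_strictMinPow` discharges
  `B_p ≤ 1` from the untied certificate.
* §4 THE SCOPE IS SHARP — at a place with WILD different the implication FAILS at cell level: `wild_witness` (`e = p = 5`, different exponent
  `9 = 2e − 1` — e.g. `ℚ₅(5^{1/5})`, [SerreLocalFields1979] III §6 —, `j = 2`, `m_q = 6`, `B = r_out♯(5,5) = 0`): the different-priced cell holds
  (`18 ≤ 18`) and the slot cell fails (`20 ≰ 16`). So row 16's WILD half does NOT ride row 15; it stays the candidate's open content.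

TABLE AGREEMENT (abc-iut-rh-num-1 `HULL-REACH-CELLS-v5.tsv`, 2404 groups; this seat's check 19:2xZ): on the 2126 groups with `p ∤ e_w` — ALL 256 lamSeven,
208/272 HEX-strip (every `l ≠ 7` type), 751/801 frey:szpiro-bad, 825/985 frey:szpiro-bad∧window, 73 hex-v2, 5 concrete, 8 quad — «row 16 POS ⟹ row 15
POS» holds WITHOUT EXCEPTION (lamSeven 32 ⊆ 86, HEX-strip 55 ⊆ 133, frey 297 ⊆ 310, frey∧window 509 ⊆ 726); the only 2 groups of the whole table
with row 16 POS and row 15 not POS are HEX:1:7@ev6 and HEX:2:7@ev6 (`p = 7 ∣ e_w = 42`, the `(tie)` type `e = p(p−1)`), outside this file's scope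
by BOTH clauses. In particular row 16's declared slice «HEX/lamSeven k ≤ 2» rides row 15's door on lamSeven (32/32 groups, all `7 ∤ e_w`) and on the
48 HEX-strip slice groups with `l ≠ 7`. [cite: Mochizuki2012, IUTchI Ex. 3.2 (iv) p. 71; IUTchIV Prop. 1.1 p. 9, Prop. 1.2 (i) p. 10]
[cite: SerreLocalFields1979, Ch. III §6 Prop. 13] [cite: DupuyHilado2025, §3.9, §4.9] [claim: Mochizuki2012, status: disputed] for every IUT locution.
Axioms: standard.
-/

noncomputable section

open Set Function NumberField IsDedekindDomain
open scoped Pointwise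

namespace Summit.ABC.IUTFork.Repair.RH.DiffPricedVsSlotReach

open Summit.ABC.IUTFork.Repair Summit.ABC.IUTFork.Repair.RH

/-! ## §1. Arithmetic: the tame-different cell is the band cell at `B = 1`, hence the slot cell for every `B ≤ 1` -/

/-- **TAME-DIFFERENT CELL ⟹ BAND CELL for every `B ≤ 1`** (`𝔪_w`-units, `j = i+1`): «`(j²−1)·m_q ≤ j·(e−1)`» is abc-iut-rp-m2's band cell
«`(j²−1)·m_q ≤ j·(e − B) + (1 − B)`» at `B = 1`, and the band cell is antitone in `B` (`RHHeightClassGlue.bandCell_mono`). [folklore] -/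
theorem bandCell_of_tameDiffCell {e B mq : ℤ} (i : ℕ) (hB : B ≤ 1)
    (h : (((i : ℤ) + 1) ^ 2 - 1) * mq ≤ ((i : ℤ) + 1) * (e - 1)) :
    (((i : ℤ) + 1) ^ 2 - 1) * mq ≤ ((i : ℤ) + 1) * (e - B) + (1 - B) := by
  have h1 : (((i : ℤ) + 1) ^ 2 - 1) * mq ≤ ((i : ℤ) + 1) * (e - 1) + (1 - 1) := by linarith
  exact RHHeightClassGlue.bandCell_mono i hB h1

/-- **TAME-DIFFERENT CELL ⟹ ROW 15's INTEGER SLOT CELL** at inner conductor `A = 1` and any outer exponent `B ≤ 1`: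
`e·⌊(j²·m_q − 1)/e⌋ ≤ m_q − B + j·(e·⌈1/e⌉ − B)` — the `(w, j)` cell of `RHSlotReach.slotReachWindowK_iff_cells_of_uniform`
(via `RHHeightClassGlue.slotCell_of_bandCell`). [folklore] -/
theorem slotCell_of_tameDiffCell {e : ℕ} {B mq : ℤ} (he : 1 ≤ e) (i : ℕ) (hB : B ≤ 1)
    (h : (((i : ℤ) + 1) ^ 2 - 1) * mq ≤ ((i : ℤ) + 1) * ((e : ℤ) - 1)) :
    (e : ℤ) * (((((i : ℤ) + 1) ^ 2) * mq - ((1 : ℕ) : ℕ)) / (e : ℤ)) ≤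
      mq - B + (((i + 1 : ℕ)) : ℤ) * ((e : ℤ) * (-((-(((1 : ℕ) : ℕ) : ℤ)) / (e : ℤ))) - B) :=
  RHHeightClassGlue.slotCell_of_bandCell he (le_refl 1) i (bandCell_of_tameDiffCell i hB h)

/-- **The UNTIED outer exponent is `≤ 1`**: a strict minimum `B = p^t − t·e` of `t ↦ p^t − t·e` (column `r_out_sharp` without `(tie)` flag;
abc-iut-rh-typ-8's `RHHeightClass.StrictMinPow`) satisfies `B ≤ 1` (`RHHeightClass.strictMinPow_le_one`, the value at `t = 0`), so §1 applies at
every untied place. Restated here only as the bridge to the hypothesis shape `B ≤ 1`. [folklore] -/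
theorem outer_le_one_of_strictMinPow {p e : ℕ} {B : ℤ} (h : RHHeightClass.StrictMinPow p e B) : B ≤ 1 :=
  RHHeightClass.strictMinPow_le_one h

/-! ## §2. Fibre level: tame-different cells at the bad places ⟹ `SlotReachWindow` (any `lstar / Fib / bad`) -/

/-- **TAME-DIFFERENT CELLS ⟹ `SlotReachWindow`** for ANY label count `lstar`, fibres `Fib` and bad-place predicate `bad` (e.g. the packets of any
Dupuy–Hilado pilot datum), at the dictionary UNIFORM per prime: `e ≡ e_p ≥ 1`, `n₀ ≡ 1`, `λ ≡ −B_p/e_p` with `B_p ≤ 1` at primes under bad places,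
realising Θ-orders `mΘ(j, w) = j²·m_q(w)`; hypothesis: «`(j²−1)·m_q(w) ≤ j·(e_p − 1)`» at every bad `w` and label. Assembled from
`RHHeightClassGlue.slotReachWindow_of_bandCells` (`A ≡ 1`) and §1. [folklore] -/
theorem slotReachWindow_of_tameDiffCells {lstar : ℕ} {Fib : Nat.Primes → Type} {bad : ∀ pp, Fib pp → Prop}
    (eK : Nat.Primes → ℕ) (BK : Nat.Primes → ℤ) (heK : ∀ pp, 1 ≤ eK pp)
    {e n₀ : ∀ pp, Fib pp → ℕ} {lam : ∀ pp, Fib pp → ℝ} {mΘ : ∀ pp, Fin lstar → Fib pp → ℤ} {mq : ∀ pp, Fib pp → ℤ}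
    (he : ∀ pp x, e pp x = eK pp) (hn₀ : ∀ pp x, n₀ pp x = 1)
    (hlam : ∀ pp x, lam pp x = -((BK pp : ℤ) : ℝ) / ((eK pp : ℕ) : ℝ))
    (hmΘ : ∀ pp i w, mΘ pp i w = ((((i : ℕ) : ℤ) + 1) ^ 2) * mq pp w)
    (hBK : ∀ (pp : Nat.Primes) (w : Fib pp), bad pp w → BK pp ≤ 1)
    (hcell : ∀ (pp : Nat.Primes) (i : Fin lstar) (w : Fib pp), bad pp w →
      ((((i : ℕ) : ℤ) + 1) ^ 2 - 1) * mq pp w ≤ (((i : ℕ) : ℤ) + 1) * ((eK pp : ℤ) - 1)) :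
    RHSlotReach.SlotReachWindow lstar Fib bad e n₀ lam mΘ mq :=
  RHHeightClassGlue.slotReachWindow_of_bandCells eK (fun _ => 1) BK heK (fun _ => le_rfl) he hn₀ hlam hmΘ
    fun pp i w hw => bandCell_of_tameDiffCell (i : ℕ) (hBK pp w hw) (hcell pp i w hw)

/-! ## §3. The genuine `K`-level datum: `HStarDiffPriced D` ⟹ `SlotReachWindowK D` on the tame-different stratum -/

section Genuine

open Literature.AnabelianGeometry.AbsoluteAnabelian Literature.IUT.LogThetaLattice Literature.IUT.LogVolume
  Literature.IUT.HodgeTheaters Literature.NumberTheory.NumberFields Literature.NumberTheory.GaloisRepresentations.Ultrametric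
open Summit.ABC.IUTFork.Thm311 Summit.ABC.IUTFork.Thm311.Real Summit.ABC.IUTFork.Cor312 Summit.ABC.IUTFork.Cor312.Setting
  Summit.ABC.IUTFork.Cor312Vol Summit.ABC.IUTFork.Cor312Prov

variable {F K Fbar : Type} [Field F] [NumberField F] [Field K] [NumberField K] [Algebra F K] [Field Fbar]
  [Algebra F Fbar] [Algebra K Fbar] {E : WeierstrassCurve F} [E.IsElliptic] {l : ℕ} {Pb : BadPlacePredicates K}
  (D : InitialThetaData F K Fbar E l Pb)

/-- **ROW 16 ⟹ ROW 15 AT THE GENUINE `K`-LEVEL DATUM (tame-different stratum).** Let every BAD place `w ∣ p` of `pilotDataOfK D K` have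
ramification `e_w = e_p` uniform over `p` with `p ∤ e_p` (tame different: `e_w·d_w = e_w − 1`, `differentOrd_eq_of_not_dvd`), and read row 15's
dictionary as `e ≡ e_p`, `n₀ ≡ 1`, `λ ≡ −B_p/e_p` with `B_p ≤ 1` under bad places, `m_q(w) = P_w` the integral q-degree (`qPilot w = P_w ∈ ℕ`,
`Cor312Prov.exists_nat_qPilot_pilotDataOfK`), `mΘ = j²·m_q` (realising ideles, [IUTchI] Ex. 3.2 (iv)). Then abc-iut-lens-transfer-3's
`HStarDiffPriced D` implies abc-iut-lens-wuc-1's `SlotReachWindowK D e n₀ lam mΘ mq` — the `hH` binder of row 15's k2 chain. Per bad cell: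
p461479 `diffPricedCell_iff_bandTop_of_not_dvd` (typed cell = «`(j²−1)·P_w ≤ j·(e_w−1)`»), §1, and abc-iut-rp-m2's `slotReachWindowK_of_bandCells`.
[cite: Mochizuki2012, IUTchI Ex. 3.2 (iv) p. 71; IUTchIV Prop. 1.1 p. 9] [cite: SerreLocalFields1979, Ch. III §6 Prop. 13]
[claim: Mochizuki2012, status: disputed] for the candidates; the implication is bookkeeping + §1 arithmetic. -/
theorem slotReachWindowK_of_hStarDiffPriced (eK : Nat.Primes → ℕ) (BK : Nat.Primes → ℤ) (heK : ∀ pp, 1 ≤ eK pp)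
    (e n₀ : ∀ pp : Nat.Primes, (thetaIndex (pilotDataOfK D K)).Fibre (.inr pp) → ℕ)
    (lam : ∀ pp : Nat.Primes, (thetaIndex (pilotDataOfK D K)).Fibre (.inr pp) → ℝ)
    (mΘ : ∀ pp : Nat.Primes, Fin (thetaIndex (pilotDataOfK D K)).lstar → (thetaIndex (pilotDataOfK D K)).Fibre (.inr pp) → ℤ)
    (mq : ∀ pp : Nat.Primes, (thetaIndex (pilotDataOfK D K)).Fibre (.inr pp) → ℤ)
    (he : ∀ pp x, e pp x = eK pp) (hn₀ : ∀ pp x, n₀ pp x = 1)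
    (hlam : ∀ pp x, lam pp x = -((BK pp : ℤ) : ℝ) / ((eK pp : ℕ) : ℝ))
    (hmΘ : ∀ pp i w, mΘ pp i w = ((((i : ℕ) : ℤ) + 1) ^ 2) * mq pp w)
    (hram : ∀ (pp : Nat.Primes) (w : (thetaIndex (pilotDataOfK D K)).Fibre (.inr pp)), haveI : Fact (pp : ℕ).Prime := ⟨pp.2⟩
      placeOf (pilotDataOfK D K) pp.1 w ∈ (pilotDataOfK D K).S → (placeOf (pilotDataOfK D K) pp.1 w).asIdeal.ramificationIdx ℤ = eK pp)
    (hnd : ∀ (pp : Nat.Primes) (w : (thetaIndex (pilotDataOfK D K)).Fibre (.inr pp)), haveI : Fact (pp : ℕ).Prime := ⟨pp.2⟩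
      placeOf (pilotDataOfK D K) pp.1 w ∈ (pilotDataOfK D K).S → ¬ (pp : ℕ) ∣ eK pp)
    (hmq : ∀ (pp : Nat.Primes) (w : (thetaIndex (pilotDataOfK D K)).Fibre (.inr pp)), haveI : Fact (pp : ℕ).Prime := ⟨pp.2⟩
      placeOf (pilotDataOfK D K) pp.1 w ∈ (pilotDataOfK D K).S →
        (mq pp w : ℝ) = (pilotDataOfK D K).qPilot (placeOf (pilotDataOfK D K) pp.1 w))
    (hBK : ∀ (pp : Nat.Primes) (w : (thetaIndex (pilotDataOfK D K)).Fibre (.inr pp)), haveI : Fact (pp : ℕ).Prime := ⟨pp.2⟩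
      placeOf (pilotDataOfK D K) pp.1 w ∈ (pilotDataOfK D K).S → BK pp ≤ 1)
    (hH : DiffPriced.HStarDiffPriced D) :
    RHSlotReach.SlotReachWindowK D e n₀ lam mΘ mq := by
  refine RHHeightClassGlue.slotReachWindowK_of_bandCells D eK (fun _ => 1) BK heK (fun _ => le_rfl) e n₀ lam mΘ mq he hn₀ hlam hmΘ
    fun pp i w hw => ?_
  haveI : Fact (pp : ℕ).Prime := ⟨pp.2⟩
  have hw' : placeOf (pilotDataOfK D K) pp.1 w ∈ (pilotDataOfK D K).S := hw
  obtain ⟨P, hP, -, -⟩ := exists_nat_qPilot_pilotDataOfK D hw'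
  have hnd' : ¬ (pp : ℕ) ∣ (placeOf (pilotDataOfK D K) pp.1 w).asIdeal.ramificationIdx ℤ := by
    rw [hram pp w hw']
    exact hnd pp w hw'
  have hcell := (DiffPricedVsTameBand.diffPricedCell_iff_bandTop_of_not_dvd D pp w hnd' hP ((i : ℕ) + 1)).1 (hH pp i w hw')
  rw [hram pp w hw'] at hcell
  have hmqP : mq pp w = (P : ℤ) := by
    have h1 : ((mq pp w : ℤ) : ℝ) = (((P : ℕ) : ℤ) : ℝ) := by
      rw [hmq pp w hw', hP]
      push_cast
      rfl
    exact_mod_cast h1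
  rw [hmqP]
  refine bandCell_of_tameDiffCell (i : ℕ) (hBK pp w hw') ?_
  push_cast at hcell ⊢
  linarith

/-- **… with `B_p` the UNTIED sharp outer exponent** (`RHHeightClass.StrictMinPow p e_p B_p` at the primes under bad places — column `r_out_sharp`
without `(tie)` flag, certified as a member valuation of `log_p 𝒪_w^×` by `RHSlotReach.exists_hrad_sharp` / `RHHeightClassGlue`): the hypothesis
`B_p ≤ 1` is discharged (`strictMinPow_le_one`), so ROW 16 ⟹ ROW 15 at the COLUMN dictionary `(A, B) = (1, r_out♯)` on every genuine datum whose
bad places have tame different and untied type. [cite: Mochizuki2012, IUTchI Ex. 3.2 (iv) p. 71; IUTchIV Prop. 1.1 p. 9]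
[claim: Mochizuki2012, status: disputed] -/
theorem slotReachWindowK_of_hStarDiffPriced_of_strictMinPow (eK : Nat.Primes → ℕ) (BK : Nat.Primes → ℤ) (heK : ∀ pp, 1 ≤ eK pp)
    (e n₀ : ∀ pp : Nat.Primes, (thetaIndex (pilotDataOfK D K)).Fibre (.inr pp) → ℕ)
    (lam : ∀ pp : Nat.Primes, (thetaIndex (pilotDataOfK D K)).Fibre (.inr pp) → ℝ)
    (mΘ : ∀ pp : Nat.Primes, Fin (thetaIndex (pilotDataOfK D K)).lstar → (thetaIndex (pilotDataOfK D K)).Fibre (.inr pp) → ℤ)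
    (mq : ∀ pp : Nat.Primes, (thetaIndex (pilotDataOfK D K)).Fibre (.inr pp) → ℤ)
    (he : ∀ pp x, e pp x = eK pp) (hn₀ : ∀ pp x, n₀ pp x = 1)
    (hlam : ∀ pp x, lam pp x = -((BK pp : ℤ) : ℝ) / ((eK pp : ℕ) : ℝ))
    (hmΘ : ∀ pp i w, mΘ pp i w = ((((i : ℕ) : ℤ) + 1) ^ 2) * mq pp w)
    (hram : ∀ (pp : Nat.Primes) (w : (thetaIndex (pilotDataOfK D K)).Fibre (.inr pp)), haveI : Fact (pp : ℕ).Prime := ⟨pp.2⟩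
      placeOf (pilotDataOfK D K) pp.1 w ∈ (pilotDataOfK D K).S → (placeOf (pilotDataOfK D K) pp.1 w).asIdeal.ramificationIdx ℤ = eK pp)
    (hnd : ∀ (pp : Nat.Primes) (w : (thetaIndex (pilotDataOfK D K)).Fibre (.inr pp)), haveI : Fact (pp : ℕ).Prime := ⟨pp.2⟩
      placeOf (pilotDataOfK D K) pp.1 w ∈ (pilotDataOfK D K).S → ¬ (pp : ℕ) ∣ eK pp)
    (hmq : ∀ (pp : Nat.Primes) (w : (thetaIndex (pilotDataOfK D K)).Fibre (.inr pp)), haveI : Fact (pp : ℕ).Prime := ⟨pp.2⟩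
      placeOf (pilotDataOfK D K) pp.1 w ∈ (pilotDataOfK D K).S →
        (mq pp w : ℝ) = (pilotDataOfK D K).qPilot (placeOf (pilotDataOfK D K) pp.1 w))
    (hsharp : ∀ (pp : Nat.Primes) (w : (thetaIndex (pilotDataOfK D K)).Fibre (.inr pp)), haveI : Fact (pp : ℕ).Prime := ⟨pp.2⟩
      placeOf (pilotDataOfK D K) pp.1 w ∈ (pilotDataOfK D K).S → RHHeightClass.StrictMinPow pp (eK pp) (BK pp))
    (hH : DiffPriced.HStarDiffPriced D) :
    RHSlotReach.SlotReachWindowK D e n₀ lam mΘ mq :=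
  slotReachWindowK_of_hStarDiffPriced D eK BK heK e n₀ lam mΘ mq he hn₀ hlam hmΘ hram hnd hmq
    (fun pp w hw => outer_le_one_of_strictMinPow (hsharp pp w hw)) hH

end Genuine

/-! ## §4. The scope is sharp: at a place with WILD different, row 16 does not imply row 15 -/

/-- **WILD WITNESS (cell level).** Type `e = p = 5` with different exponent `e·d = 9 = 2e − 1` (the maximum `e − 1 + e·v_p(e)`; e.g. the
completion `ℚ₅(5^{1/5})`, [SerreLocalFields1979] III §6), untied outer exponent `B = r_out♯(5, 5) = 5¹ − 1·5 = 0` (`StrictMinPow 5 5 0`), label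
`j = 2`, `m_q = 6`: abc-iut-lens-transfer-3's different-priced cell HOLDS (`(4−1)·6 = 18 ≤ 2·9`), yet row 15's integer slot cell at `(A, B) = (1, 0)`
FAILS (`5·⌊23/5⌋ = 20 ≰ 6 − 0 + 2·(5 − 0) = 16`). Hence no «ROW 16 ⟹ ROW 15» at places with `p ∣ e_w`; the 2 table groups with row 16 POS and
row 15 not POS (HEX:1:7@ev6, HEX:2:7@ev6, `7 ∣ 42`) lie on that side. [cite: SerreLocalFields1979, Ch. III §6 Prop. 13] [folklore] -/
theorem wild_witness :
    DiffPriced.Cell 2 6 5 ((9 : ℝ) / 5) ∧ RHHeightClass.StrictMinPow 5 5 0 ∧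
      ¬ ((5 : ℤ) * ((((1 : ℤ) + 1) ^ 2 * 6 - ((1 : ℕ) : ℕ)) / (5 : ℤ)) ≤
          6 - 0 + (((1 + 1 : ℕ)) : ℤ) * ((5 : ℤ) * (-((-(((1 : ℕ) : ℕ) : ℤ)) / (5 : ℤ))) - 0)) := by
  refine ⟨?_, ?_, by decide⟩
  · simp only [DiffPriced.Cell]
    norm_num
  · refine ⟨1, by norm_num, fun t' ht' => ?_⟩
    rcases Nat.lt_or_ge t' 3 with h | h
    · interval_cases t' <;> simp_all
    · -- `5^t' − 5·t' ≥ 5^3 − 15 > 0` for `t' ≥ 3`: `5^t' ≥ 25·t'`... use monotone growth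
      have h5 : (25 : ℤ) * t' ≤ (5 : ℤ) ^ t' := by
        have key : ∀ n : ℕ, 3 ≤ n → (25 : ℤ) * n ≤ (5 : ℤ) ^ n := by
          intro n hn
          induction n with
          | zero => omega
          | succ k ih =>
            rcases Nat.lt_or_ge k 3 with hk | hk
            · interval_cases k <;> omega
            · have := ih hk
              rw [pow_succ]
              push_cast
              nlinarith
        exact key t' h
      push_cast
      nlinarith

end Summit.ABC.IUTFork.Repair.RH.DiffPricedVsSlotReach

end

/-! ## §5. (APPENDED 2026-08-26, v2) THE CHECKABLE-COLUMN SIDE CONDITION «δ_w + B_p ≤ e_w» (abc-iut-rh-tst-5 g2, 19:25:15Z) — wild places INCLUDED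

abc-iut-rh-tst-5's sharper reading of §1: what the arithmetic uses is not tameness of the different but ONE inequality between three columns —
the different exponent `δ_w = e_w·d_w` (I06STAR / WINDOW-TABLE col 14), the outer exponent `B` (col `R_out♯`, untied `≤ 1`) and the
ramification index: **`δ_w + B ≤ e_w`** (tame: `δ = e − 1`, `B = 1`, EQUALITY; HEX-type wild places: `B = r_out♯ ≪ 0`, room). Under it the
different-priced cell `(j²−1)·m_q ≤ j·δ_w` implies abc-iut-rp-m2's band cell at `B` (`j·δ ≤ j·(e − B)`, `0 ≤ 1 − B`), hence row 15's slot cell —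
the tester's `win_of_cell_of_add_le` (HOME/staging/RH/abc-iut-rh-tst-5/RHDiffPricedLinkCell.lean dc5290d4788e1ac0), inlined here in the band-cell
currency with credit; its sharpness is the tester's counter-cell `(p, e, δ, m_q, j) = (7, 7, 13, 8, 2)` and §4's `wild_witness` (both violate
`δ + B ≤ e`: `13 + 0 > 7`, `9 + 0 > 5`). The §3 theorem is the special case `δ = e − 1`. Extensionally (tst-5, WINDOW-TABLE v4.9): the side condition
holds on 2699/2700 (row, δ-end) pairs (the exception is H⋆₁₆-NEG) and on 48/48 of row 16's slice. -/

namespace Summit.ABC.IUTFork.Repair.RH.DiffPricedVsSlotReach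

/-- **DIFFERENT-PRICED CELL ⟹ BAND CELL under `δ + B ≤ e`, `B ≤ 1`** (`𝔪_w`-units, `j = i+1`; abc-iut-rh-tst-5's side condition):
«`(j²−1)·m_q ≤ j·δ`» with `δ + B ≤ e` and `B ≤ 1` gives «`(j²−1)·m_q ≤ j·(e − B) + (1 − B)`». [folklore] -/
theorem bandCell_of_diffCell_of_add_le {e B δ mq : ℤ} (i : ℕ) (hB : B ≤ 1) (hδ : δ + B ≤ e)
    (h : (((i : ℤ) + 1) ^ 2 - 1) * mq ≤ ((i : ℤ) + 1) * δ) :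
    (((i : ℤ) + 1) ^ 2 - 1) * mq ≤ ((i : ℤ) + 1) * (e - B) + (1 - B) := by
  have hj : (0 : ℤ) ≤ (i : ℤ) + 1 := by positivity
  have h1 : ((i : ℤ) + 1) * δ ≤ ((i : ℤ) + 1) * (e - B) := mul_le_mul_of_nonneg_left (by linarith) hj
  linarith

/-- **DIFFERENT-PRICED CELLS ⟹ `SlotReachWindow` under the column condition** (any `lstar / Fib / bad`; dictionary uniform per prime `e ≡ e_p ≥ 1`,
`n₀ ≡ 1`, `λ ≡ −B_p/e_p`, `mΘ = j²·m_q`; per-PLACE different exponents `δ_w`): if at every bad place `δ_w + B_p ≤ e_p`, `B_p ≤ 1` and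
«`(j²−1)·m_q(w) ≤ j·δ_w`» at every label, then `SlotReachWindow`. Wild places are allowed. [folklore] -/
theorem slotReachWindow_of_diffCells_of_add_le {lstar : ℕ} {Fib : Nat.Primes → Type} {bad : ∀ pp, Fib pp → Prop}
    (eK : Nat.Primes → ℕ) (BK : Nat.Primes → ℤ) (heK : ∀ pp, 1 ≤ eK pp) (δ : ∀ pp, Fib pp → ℤ)
    {e n₀ : ∀ pp, Fib pp → ℕ} {lam : ∀ pp, Fib pp → ℝ} {mΘ : ∀ pp, Fin lstar → Fib pp → ℤ} {mq : ∀ pp, Fib pp → ℤ}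
    (he : ∀ pp x, e pp x = eK pp) (hn₀ : ∀ pp x, n₀ pp x = 1)
    (hlam : ∀ pp x, lam pp x = -((BK pp : ℤ) : ℝ) / ((eK pp : ℕ) : ℝ))
    (hmΘ : ∀ pp i w, mΘ pp i w = ((((i : ℕ) : ℤ) + 1) ^ 2) * mq pp w)
    (hBK : ∀ (pp : Nat.Primes) (w : Fib pp), bad pp w → BK pp ≤ 1)
    (hδ : ∀ (pp : Nat.Primes) (w : Fib pp), bad pp w → δ pp w + BK pp ≤ eK pp)
    (hcell : ∀ (pp : Nat.Primes) (i : Fin lstar) (w : Fib pp), bad pp w →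
      ((((i : ℕ) : ℤ) + 1) ^ 2 - 1) * mq pp w ≤ (((i : ℕ) : ℤ) + 1) * δ pp w) :
    RHSlotReach.SlotReachWindow lstar Fib bad e n₀ lam mΘ mq :=
  RHHeightClassGlue.slotReachWindow_of_bandCells eK (fun _ => 1) BK heK (fun _ => le_rfl) he hn₀ hlam hmΘ
    fun pp i w hw => bandCell_of_diffCell_of_add_le (i : ℕ) (hBK pp w hw) (hδ pp w hw) (hcell pp i w hw)

section GenuineColumn

open Literature.AnabelianGeometry.AbsoluteAnabelian Literature.IUT.LogThetaLattice Literature.IUT.LogVolume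
  Literature.IUT.HodgeTheaters Literature.NumberTheory.NumberFields Literature.NumberTheory.GaloisRepresentations.Ultrametric
open Summit.ABC.IUTFork.Thm311 Summit.ABC.IUTFork.Thm311.Real Summit.ABC.IUTFork.Cor312 Summit.ABC.IUTFork.Cor312.Setting
  Summit.ABC.IUTFork.Cor312Vol Summit.ABC.IUTFork.Cor312Prov

variable {F K Fbar : Type} [Field F] [NumberField F] [Field K] [NumberField K] [Algebra F K] [Field Fbar]
  [Algebra F Fbar] [Algebra K Fbar] {E : WeierstrassCurve F} [E.IsElliptic] {l : ℕ} {Pb : BadPlacePredicates K}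
  (D : InitialThetaData F K Fbar E l Pb)

/-- **ROW 16 ⟹ ROW 15 AT THE GENUINE `K`-LEVEL DATUM under the column condition «`e_w·d_w + B_p ≤ e_p`» (wild places INCLUDED).**
Read row 15's dictionary as `e ≡ e_p ≥ 1`, `n₀ ≡ 1`, `λ ≡ −B_p/e_p` (`B_p ≤ 1` under bad places), `m_q(w) = P_w ∈ ℕ` the integral q-degree, `mΘ = j²·m_q`.
If at every BAD place `w ∣ p` the different exponent in `ord_w`-units, `e(K_w/ℚ_p)·differentOrd p K_w` ([IUTchIV] Prop. 1.1; the `e·d` of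
abc-iut-lens-transfer-3's `DiffPriced.Cell`), satisfies `e(K_w/ℚ_p)·d_w + B_p ≤ e_p` (abc-iut-rh-tst-5's side condition; at a tame place with `e_p = e_w`
it is `B_p ≤ 1`), then `HStarDiffPriced D ⟹ SlotReachWindowK D e n₀ lam mΘ mq`. No hypothesis `p ∤ e_w` and no identification `e_p = e_w` is used
here (the k2 door pins `e_p` to `e_w` through its norm uniformizer `‖ϖ_x‖ = p^{−1/e_p}`). [cite: Mochizuki2012, IUTchI Ex. 3.2 (iv) p. 71;
IUTchIV Prop. 1.1 p. 9] [claim: Mochizuki2012, status: disputed] for the candidates; the implication is bookkeeping + arithmetic. -/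
theorem slotReachWindowK_of_hStarDiffPriced_of_diff_add_outer_le (eK : Nat.Primes → ℕ) (BK : Nat.Primes → ℤ) (heK : ∀ pp, 1 ≤ eK pp)
    (e n₀ : ∀ pp : Nat.Primes, (thetaIndex (pilotDataOfK D K)).Fibre (.inr pp) → ℕ)
    (lam : ∀ pp : Nat.Primes, (thetaIndex (pilotDataOfK D K)).Fibre (.inr pp) → ℝ)
    (mΘ : ∀ pp : Nat.Primes, Fin (thetaIndex (pilotDataOfK D K)).lstar → (thetaIndex (pilotDataOfK D K)).Fibre (.inr pp) → ℤ)
    (mq : ∀ pp : Nat.Primes, (thetaIndex (pilotDataOfK D K)).Fibre (.inr pp) → ℤ)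
    (he : ∀ pp x, e pp x = eK pp) (hn₀ : ∀ pp x, n₀ pp x = 1)
    (hlam : ∀ pp x, lam pp x = -((BK pp : ℤ) : ℝ) / ((eK pp : ℕ) : ℝ))
    (hmΘ : ∀ pp i w, mΘ pp i w = ((((i : ℕ) : ℤ) + 1) ^ 2) * mq pp w)
    (hmq : ∀ (pp : Nat.Primes) (w : (thetaIndex (pilotDataOfK D K)).Fibre (.inr pp)), haveI : Fact (pp : ℕ).Prime := ⟨pp.2⟩
      placeOf (pilotDataOfK D K) pp.1 w ∈ (pilotDataOfK D K).S →
        (mq pp w : ℝ) = (pilotDataOfK D K).qPilot (placeOf (pilotDataOfK D K) pp.1 w))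
    (hBK : ∀ (pp : Nat.Primes) (w : (thetaIndex (pilotDataOfK D K)).Fibre (.inr pp)), haveI : Fact (pp : ℕ).Prime := ⟨pp.2⟩
      placeOf (pilotDataOfK D K) pp.1 w ∈ (pilotDataOfK D K).S → BK pp ≤ 1)
    (hdiff : ∀ (pp : Nat.Primes) (w : (thetaIndex (pilotDataOfK D K)).Fibre (.inr pp)), haveI : Fact (pp : ℕ).Prime := ⟨pp.2⟩
      placeOf (pilotDataOfK D K) pp.1 w ∈ (pilotDataOfK D K).S →
        (absRamificationIdx (pp : ℕ) (kOf (pilotDataOfK D K) pp.1 w) : ℝ) * differentOrd (pp : ℕ) (kOf (pilotDataOfK D K) pp.1 w)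
          + ((BK pp : ℤ) : ℝ) ≤ ((eK pp : ℕ) : ℝ))
    (hH : DiffPriced.HStarDiffPriced D) :
    RHSlotReach.SlotReachWindowK D e n₀ lam mΘ mq := by
  refine RHHeightClassGlue.slotReachWindowK_of_bandCells D eK (fun _ => 1) BK heK (fun _ => le_rfl) e n₀ lam mΘ mq he hn₀ hlam hmΘ
    fun pp i w hw => ?_
  haveI : Fact (pp : ℕ).Prime := ⟨pp.2⟩
  have hw' : placeOf (pilotDataOfK D K) pp.1 w ∈ (pilotDataOfK D K).S := hw
  obtain ⟨P, hP, -, -⟩ := exists_nat_qPilot_pilotDataOfK D hw'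
  have hcell := hH pp i w hw'
  simp only [DiffPriced.Cell, hP] at hcell
  have hmqP : mq pp w = (P : ℤ) := by
    have h1 : ((mq pp w : ℤ) : ℝ) = (((P : ℕ) : ℤ) : ℝ) := by
      rw [hmq pp w hw', hP]
      push_cast
      rfl
    exact_mod_cast h1
  rw [hmqP]
  have hj : (0 : ℝ) ≤ (((i : ℕ) + 1 : ℕ) : ℝ) := by positivity
  have hd := hdiff pp w hw'
  have hB : ((BK pp : ℤ) : ℝ) ≤ 1 := by exact_mod_cast hBK pp w hw'
  -- real band cell: `(j²−1)·P ≤ j·(e·d) ≤ j·(e_p − B_p) ≤ j·(e_p − B_p) + (1 − B_p)`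
  have h2 : (((i : ℕ) + 1 : ℕ) : ℝ) *
      ((absRamificationIdx (pp : ℕ) (kOf (pilotDataOfK D K) pp.1 w) : ℝ) * differentOrd (pp : ℕ) (kOf (pilotDataOfK D K) pp.1 w))
        ≤ (((i : ℕ) + 1 : ℕ) : ℝ) * (((eK pp : ℕ) : ℝ) - ((BK pp : ℤ) : ℝ)) :=
    mul_le_mul_of_nonneg_left (by linarith) hj
  have hreal : (((((i : ℕ) : ℤ) + 1) ^ 2 - 1) * (P : ℤ) : ℝ) ≤
      ((((i : ℕ) : ℤ) + 1) * ((eK pp : ℤ) - BK pp) + (1 - BK pp) : ℝ) := by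
    push_cast at hcell h2 ⊢
    linarith
  exact_mod_cast hreal

end GenuineColumn

end Summit.ABC.IUTFork.Repair.RH.DiffPricedVsSlotReach
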